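import Mathlib
import HarnessLib
import Literature.NumberTheory.LFunctions.MoebiusCharacterSumData

/-!
# `DilatedChowla` (stmt-Parity-13319): the explicit exceptional branch of Landau's method for `μχ`

Line `Sketch` (card `siegel-mirror`), stub A (`moebiusExcLaw`), part 1 of 2.  The tree's
`Literature.NumberTheory.LFunctions.MoebiusTwist.exists_excPsiData_twist` verifies the hypotheses
`ExcPsiData` of the Landau engine with an exceptional zero (`ExceptionalZeroPsi.lean`) for the
non-negative sequences `Λ'(n) = 1 + λ Re(w χ(n)) μ(n)`, but hides the exceptional zero `β` and the
residue `α` behind an existential.  For the mirror line we need them EXPLICITLY: given a real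
character `ψ ≠ 1 mod k` and a real zero `β > 1 − 2c₁/(log k + log 4)` of `L(s, ψ)`, the data
`ExcPsiData Λ' F c C₀ (log k) β α` hold with THIS `β` and with `α = −λ Re(w) Re(1/L'(β, ψ))`
(`λ = 1/(K(log k + log 4) + 1)`), together with `L'(β, ψ) ≠ 0`, `|1/L'(β, ψ)| ≤ K (log k + log 4)`,
`β < 1`, and — with the SAME absolute `c₁` — the Landau–Page uniqueness of such a zero.  The proof
is the exceptional case of the tree's proof, verbatim (Montgomery–Vaughan §11.3 Exercises 7–8 with
Theorem 11.4 (11.7)/(11.10), tree `DirichletZFR.exists_inv_LFunction_bounds`, and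
`ζ(s) − 1/(s−1) ≪ log(|t|+4)`, tree `MoebiusTwist.exists_norm_riemannZeta₀_le`).  No cited facts.
-/

noncomputable section

namespace Summit.Parity.GeneralizedHardyLittlewood.Theorems.DilatedChowla.Negative

open Complex Filter Topology Metric Set Finset
open scoped ArithmeticFunction.Moebius ComplexConjugate
open Literature.NumberTheory.LFunctions
open Literature.NumberTheory.LFunctions.MoebiusTwist

set_option maxHeartbeats 1600000 in
/-- **Landau's data for `1 + λ Re(w ψ(n)) μ(n)` at an exceptional zero, explicit form.**  There are
absolute constants `0 < c ≤ 1/2`, `0 < c₁ ≤ 1/4`, `K ≥ 0`, `C₀ ≥ 0` such that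
(uniqueness) a non-principal character mod `k` has at most one real zero `> 1 − 2c₁/(log k + log 4)`,
and (data) for every real character `ψ ≠ 1 mod k`, every `|w| ≤ 1` and every real zero
`β > 1 − 2c₁/(log k + log 4)` of `L(s, ψ)`: `L'(β, ψ) ≠ 0`, `‖1/L'(β, ψ)‖ ≤ K (log k + log 4)`,
`β < 1`, and with `λ = 1/(K (log k + log 4) + 1)` the sequence `1 + λ Re(w ψ(n)) μ(n)` satisfies
`ExcPsiData · F c C₀ (log k) β (−λ Re(w) Re(1/L'(β, ψ)))` for some `F`
(namely `F = ζ₀ + λ Re(w) · dslope (1/g) β`, `g = L(s, ψ)/(s − β)`). -/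
theorem mexc_excPsiData :
    ∃ c : ℝ, 0 < c ∧ c ≤ 1 / 2 ∧ ∃ c₁ : ℝ, 0 < c₁ ∧ c₁ ≤ 1 / 4 ∧ ∃ K : ℝ, 0 ≤ K ∧
      ∃ C₀ : ℝ, 0 ≤ C₀ ∧
      (∀ (k : ℕ) [NeZero k] (ψ : DirichletCharacter ℂ k), ψ ≠ 1 → ∀ β β' : ℝ,
        ψ.LFunction β = 0 → ψ.LFunction β' = 0 →
        1 - 2 * c₁ / (Real.log k + Real.log 4) < β → 1 - 2 * c₁ / (Real.log k + Real.log 4) < β' →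
        β = β') ∧
      ∀ (k : ℕ) [NeZero k] (ψ : DirichletCharacter ℂ k), ψ ≠ 1 → ψ ^ 2 = 1 → ∀ w : ℂ, ‖w‖ ≤ 1 →
        ∀ β : ℝ, 1 - 2 * c₁ / (Real.log k + Real.log 4) < β → ψ.LFunction β = 0 →
          deriv ψ.LFunction β ≠ 0 ∧
          ‖(deriv ψ.LFunction β)⁻¹‖ ≤ K * (Real.log k + Real.log 4) ∧
          β < 1 ∧
          ∃ F : ℂ → ℂ, ExcPsiData
            (fun n : ℕ ↦ 1 + 1 / (K * (Real.log k + Real.log 4) + 1) *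
              (w * ψ (n : ZMod k) * (μ n : ℂ)).re)
            F c C₀ (Real.log k) β
            (-(1 / (K * (Real.log k + Real.log 4) + 1) * w.re *
              ((deriv ψ.LFunction β)⁻¹).re)) := by
  obtain ⟨c₁, hc₁, hc₁4, C₁, hC₁, -, huniq, -, hB⟩ := DirichletZFR.exists_inv_LFunction_bounds
  obtain ⟨cζ, hcζ, Cζ, hCζ, hζ⟩ := exists_norm_riemannZeta₀_le
  set c : ℝ := min c₁ (min cζ (1 / 2)) with hcdef
  have hcc₁ : c ≤ c₁ := min_le_left _ _
  have hccζ : c ≤ cζ := (min_le_right _ _).trans (min_le_left _ _)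
  have hc2 : c ≤ 1 / 2 := (min_le_right _ _).trans (min_le_right _ _)
  have hcpos : 0 < c := lt_min hc₁ (lt_min hcζ (by norm_num))
  clear_value c
  refine ⟨c, hcpos, hc2, c₁, hc₁, hc₁4, C₁, hC₁, Cζ + 2, by positivity, huniq,
    fun k _ ψ hψ hψ2 w hw β hβc hβ ↦ ?_⟩
  -- quantities at the modulus `k`
  have hlogq : 0 ≤ Real.log k := Real.log_natCast_nonneg k
  set ℒ₀ : ℝ := Real.log k + Real.log 4 with hℒ₀
  have hℒ₀1 : 1 ≤ ℒ₀ := PagePNT.one_le_ell0 k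
  have hℒ₀0 : 0 < ℒ₀ := by linarith
  set lam : ℝ := 1 / (C₁ * ℒ₀ + 1) with hlam
  have hlam0 : 0 < lam := by rw [hlam]; positivity
  have hlam1 : lam ≤ 1 := by
    rw [hlam, div_le_one (by positivity)]; nlinarith
  have hlamC : lam * (C₁ * ℒ₀) ≤ 1 := by
    rw [hlam, div_mul_eq_mul_div, one_mul, div_le_one (by positivity)]; linarith
  have hwre : |w.re| ≤ 1 := (Complex.abs_re_le_norm w).trans hw
  -- common analytic facts at a point of the region
  have hreg : ∀ s : ℂ, 1 - c / (Real.log k + Real.log (|s.im| + 4)) < s.re →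
      1 - c₁ / (Real.log k + Real.log (|s.im| + 4)) ≤ s.re ∧
      ‖riemannZeta₀ s‖ ≤ Cζ * Real.log (|s.im| + 4) ∧
      1 ≤ Real.log (|s.im| + 4) ∧
      lam * (C₁ * (Real.log k + Real.log (|s.im| + 4))) ≤ Real.log (|s.im| + 4) := by
    intro s hs
    obtain ⟨h1, h2⟩ := region_mono hcpos hcc₁ hccζ hs
    have hlt : 1 ≤ Real.log (|s.im| + 4) := ClassicalZFRData.one_le_log_tau s.im
    refine ⟨h1, hζ s h2, hlt, ?_⟩
    calc lam * (C₁ * (Real.log k + Real.log (|s.im| + 4)))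
        ≤ lam * (C₁ * (ℒ₀ * Real.log (|s.im| + 4))) := by
          refine mul_le_mul_of_nonneg_left (mul_le_mul_of_nonneg_left ?_ hC₁) hlam0.le
          exact ell_le_ell0_mul k s.im
      _ = lam * (C₁ * ℒ₀) * Real.log (|s.im| + 4) := by ring
      _ ≤ 1 * Real.log (|s.im| + 4) := mul_le_mul_of_nonneg_right hlamC (by linarith)
      _ = Real.log (|s.im| + 4) := one_mul _
  -- the coefficients
  have hnonneg : ∀ n : ℕ, 0 ≤ 1 + lam * (w * ψ (n : ZMod k) * (μ n : ℂ)).re :=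
    coeff_nonneg ψ hw hlam0.le hlam1
  have hsum : ∀ s : ℂ, 1 < s.re →
      LSeriesSummable
        (fun n : ℕ ↦ (((1 + lam * (w * ψ (n : ZMod k) * (μ n : ℂ)).re : ℝ)) : ℂ)) s :=
    fun s hs ↦ LSeriesSummable_coeff ψ hw hlam0.le hlam1 hs
  have hpow5 : ∀ x : ℝ, 1 ≤ x → x ≤ x ^ 5 := fun x hx ↦ by
    calc x = x ^ 1 := (pow_one x).symm
      _ ≤ x ^ 5 := pow_le_pow_right₀ hx (by norm_num)
  -- the exceptional zero `β` of the quadratic character `ψ`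
  have hinv : ψ⁻¹ = ψ := inv_eq_of_mul_eq_one_left (by rw [← sq, hψ2])
  obtain ⟨hderiv, hinvd, hBs⟩ := hB k ψ hψ β hβ hβc
  have hβ1 : β < 1 := by
    by_contra hcon
    exact DirichletCharacter.LFunction_ne_zero_of_one_le_re ψ (Or.inl hψ)
      (s := β) (by simpa using not_lt.1 hcon) hβ
  have hβhalf : 1 / 2 ≤ β := by
    have : 2 * c₁ / ℒ₀ ≤ 2 * c₁ := div_le_self (by positivity) hℒ₀1
    linarith
  -- `g = L/(s − β)`, `h = 1/g`, `α₀ = h(β) = 1/L'(β)` (real)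
  set g : ℂ → ℂ := dslope ψ.LFunction (β : ℂ) with hgdef
  have hgd : Differentiable ℂ g := PagePNT.differentiable_dslope_LFunction ψ hψ _
  have hgβ : g β = deriv ψ.LFunction β := by rw [hgdef, dslope_same]
  have hgβ0 : g β ≠ 0 := by rw [hgβ]; exact hderiv
  set h : ℂ → ℂ := fun z ↦ (g z)⁻¹ with hhdef
  set α₀ : ℝ := ((deriv ψ.LFunction β)⁻¹).re with hα₀
  have hα₀eq : ((α₀ : ℝ) : ℂ) = (deriv ψ.LFunction β)⁻¹ := by
    apply Complex.ext
    · simp [hα₀]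
    · rw [Complex.ofReal_im, Complex.inv_im, deriv_LFunction_ofReal_im ψ hψ hψ2 β]
      simp
  have hhβ : h β = (α₀ : ℂ) := by rw [hα₀eq, hhdef]; simp only; rw [hgβ]
  have hα₀abs : |α₀| ≤ C₁ * ℒ₀ := by
    have : |α₀| = ‖((α₀ : ℝ) : ℂ)‖ := by rw [Complex.norm_real, Real.norm_eq_abs]
    rw [this, hα₀eq]; exact hinvd
  set α : ℝ := -(lam * w.re * α₀) with hαdef
  have hαle : |α| ≤ 1 := by
    rw [hαdef, abs_neg, abs_mul, abs_mul, abs_of_pos hlam0]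
    calc lam * |w.re| * |α₀| ≤ lam * 1 * (C₁ * ℒ₀) := by gcongr
      _ = lam * (C₁ * ℒ₀) := by ring
      _ ≤ 1 := hlamC
  set F : ℂ → ℂ := fun s ↦ riemannZeta₀ s + ((lam * w.re : ℝ) : ℂ) * dslope h (β : ℂ) s
    with hFdef
  -- `L(s) ≠ 0` off `β` in the region, and the two formulas for `1/L`
  have hoff : ∀ s : ℂ, 1 - c₁ / (Real.log k + Real.log (|s.im| + 4)) ≤ s.re → s ≠ β →
      ψ.LFunction s ≠ 0 ∧ g s ≠ 0 ∧
      dslope h (β : ℂ) s = (ψ.LFunction s)⁻¹ - (α₀ : ℂ) * (s - β)⁻¹ ∧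
      ‖(ψ.LFunction s)⁻¹‖ ≤ C₁ * (Real.log k + Real.log (|s.im| + 4)) * (1 + ‖s - β‖⁻¹) := by
    intro s hs hsβ
    obtain ⟨hL0, hLb⟩ := hBs s hs hsβ
    have hg0 : g s ≠ 0 := PagePNT.dslope_ne_zero_of_ne ψ hβ hL0
    have hLg : ψ.LFunction s = (s - β) * g s := by
      rw [hgdef]; exact PagePNT.LFunction_eq_mul_dslope ψ hβ s
    have hsβ' : s - β ≠ 0 := sub_ne_zero.2 hsβ
    refine ⟨hL0, hg0, ?_, hLb⟩
    rw [dslope_of_ne _ hsβ, slope_def_field, hhβ, hLg, mul_inv]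
    simp only [hhdef]
    field_simp
  -- differentiability of `dslope h β` at points of the region
  have hdiffh : ∀ s : ℂ, 1 - c₁ / (Real.log k + Real.log (|s.im| + 4)) ≤ s.re →
      DifferentiableAt ℂ (dslope h (β : ℂ)) s := by
    intro s hs
    rcases eq_or_ne s (β : ℂ) with rfl | hsβ
    · -- `h` is analytic at `β`
      have han : AnalyticAt ℂ h β := (hgd.analyticAt _).inv hgβ0
      obtain ⟨p, hp⟩ := han
      exact (hp.has_fpower_series_dslope_fslope.analyticAt).differentiableAt
    · obtain ⟨-, hg0, -⟩ := hoff s hs hsβ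
      exact (differentiableAt_dslope_of_ne hsβ).2 (((hgd s).inv hg0))
  refine ⟨hderiv, hinvd, hβ1, F, hcpos, hc2, by positivity, hlogq, hβhalf, hβ1, hαle,
    hnonneg, hsum, fun s hs ↦ ?_, fun s hs ↦ ?_, fun s hs hsβ ↦ ?_⟩
  · -- the Dirichlet series: `ζ + λ Re(w)/L = 1/(s−1) − α/(s−β) + F`
    have hs1 : s ≠ 1 := by rintro rfl; simp at hs
    have hsβ : s ≠ (β : ℂ) := by
      intro h; rw [h, Complex.ofReal_re] at hs; linarith
    have hsreg : 1 - c₁ / (Real.log k + Real.log (|s.im| + 4)) ≤ s.re := by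
      have : 0 < c₁ / (Real.log k + Real.log (|s.im| + 4)) :=
        div_pos hc₁ (DirichletZFR.ell_pos k s.im)
      linarith
    obtain ⟨hL0, -, hds, -⟩ := hoff s hsreg hsβ
    rw [LSeries_coeff_eq ψ hw hlam0.le hlam1 hs, hinv, riemannZeta_eq_inv_sub_add hs1, hFdef]
    simp only
    rw [hds]
    have hwre' : w + conj w = ((2 * w.re : ℝ) : ℂ) := by
      rw [Complex.add_conj]
    have e1 : (lam / 2 : ℂ) * (w * (ψ.LFunction s)⁻¹ + conj w * (ψ.LFunction s)⁻¹) =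
        ((lam * w.re : ℝ) : ℂ) * (ψ.LFunction s)⁻¹ := by
      rw [← add_mul, hwre']; push_cast; ring
    rw [e1, hαdef]
    push_cast
    ring
  · -- holomorphy
    obtain ⟨hsreg, -, -, -⟩ := hreg s hs
    exact ((differentiable_riemannZeta₀ s).add
      ((hdiffh s hsreg).const_mul _)).differentiableWithinAt
  · -- the bound, off `β`
    obtain ⟨hsreg, hζb, hlt, hlamℒ⟩ := hreg s hs
    obtain ⟨hL0, -, hds, hLb⟩ := hoff s hsreg hsβ
    set lt : ℝ := Real.log (|s.im| + 4) with hltdef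
    set d : ℝ := ‖s - (β : ℂ)‖⁻¹ with hddef
    have hd0 : 0 ≤ d := inv_nonneg.2 (norm_nonneg _)
    have hcoef : ‖((lam * w.re : ℝ) : ℂ)‖ ≤ lam := by
      rw [Complex.norm_real, Real.norm_eq_abs, abs_mul, abs_of_pos hlam0]
      nlinarith
    have hpol : ‖(α₀ : ℂ) * (s - β)⁻¹‖ ≤ C₁ * ℒ₀ * d := by
      rw [norm_mul, norm_inv, Complex.norm_real, Real.norm_eq_abs]
      exact mul_le_mul_of_nonneg_right hα₀abs hd0
    have hdsb : ‖dslope h (β : ℂ) s‖ ≤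
        C₁ * (Real.log k + lt) * (1 + d) + C₁ * ℒ₀ * d := by
      rw [hds]
      exact (norm_sub_le _ _).trans (add_le_add hLb hpol)
    have hlamℒ₀ : lam * (C₁ * ℒ₀) ≤ lt := hlamC.trans hlt
    have hmain : ‖((lam * w.re : ℝ) : ℂ) * dslope h (β : ℂ) s‖ ≤ lt * (1 + d) + lt * d := by
      rw [norm_mul]
      calc ‖((lam * w.re : ℝ) : ℂ)‖ * ‖dslope h (β : ℂ) s‖
          ≤ lam * (C₁ * (Real.log k + lt) * (1 + d) + C₁ * ℒ₀ * d) :=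
            mul_le_mul hcoef hdsb (norm_nonneg _) hlam0.le
        _ = lam * (C₁ * (Real.log k + lt)) * (1 + d) + lam * (C₁ * ℒ₀) * d := by ring
        _ ≤ lt * (1 + d) + lt * d := by
            refine add_le_add (mul_le_mul_of_nonneg_right hlamℒ (by positivity))
              (mul_le_mul_of_nonneg_right hlamℒ₀ hd0)
    have hlt5 := hpow5 lt hlt
    calc ‖F s‖ ≤ ‖riemannZeta₀ s‖ + ‖((lam * w.re : ℝ) : ℂ) * dslope h (β : ℂ) s‖ :=
          norm_add_le _ _
      _ ≤ Cζ * lt + (lt * (1 + d) + lt * d) := add_le_add hζb hmain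
      _ ≤ (Cζ + 2) * lt * (1 + d) := by
          have : 0 ≤ Cζ * lt * d := by positivity
          nlinarith
      _ ≤ (Cζ + 2) * lt ^ 5 * (1 + d) := by
          refine mul_le_mul_of_nonneg_right (mul_le_mul_of_nonneg_left hlt5 (by positivity)) ?_
          positivity

end Summit.Parity.GeneralizedHardyLittlewood.Theorems.DilatedChowla.Negative

end
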